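import Summits.QuantumFields.YangMills.Theorems.VirialFluxGapBlockZeroModeField
import Summits.QuantumFields.YangMills.Theorems.VirialFluxGapCentralConeEuler
import Mathlib.Algebra.Order.Chebyshev
import HarnessLib

/-!
# Route `VirialFluxGap` (YangMills): the CENTRAL PROJECTION `π_C` — block data, the central lift `(σ√(1−|z|²), z) ∈ SU(2)`, the comb-constant
# history with the same zero modes, and `F₀∘π_C` as an EXPLICIT QUARTIC of the block averages

Brick (C1-e) of the central charts for ⟨stmt-QuantumFields-24141⟩ (LEAD design note №4 (b)∕(e): the central-chart field is
`X_c = X_z + A⁻¹(∇F₀ − ∇F₀∘π_C)` with `π_C x :=` the comb-constant history carrying the same zero modes `z(x) = P_z(Im-coordinates)`; host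
`X_fix`, ruling 2026-08-30T23:30Z).  Objects (plumbing `def`s, no `Prop`):

* `blockIm S k P ∈ ℝ³` — the average of `Im(su2Quat ·)` over the links `(i,(x,k))`, `(i,x) ∈ S` (so ✓`bsliceCoeff σ S k a = ½σ·blockIm … a`,
  `bsliceCoeff_eq_blockIm`), `seamIm P` — the seam average; ★ `normSq_blockIm_le_one` ∕ `normSq_seamIm_le_one` — `|z| ≤ 1` (Cauchy–Schwarz);
* `liftQuat σ z = (σ√(1 − |z|²), z)` — a UNIT quaternion for `|z| ≤ 1`, `σ = ±1` (`normSq_liftQuat`), on the hemisphere of `σ` with radial factor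
  `σ·Re = √(1 − |z|²) ≥ 1 − |z|²` (`sign_mul_re_liftQuat`); `centralRep σ z := quatToSU2 (liftQuat σ z) ∈ SU(2)` with `su2Quat (centralRep σ z) =
  liftQuat σ z` (`su2Quat_centralRep`); ★ `centralRep_im_su2Quat` — `centralRep σ (Im A) = U` for `A = su2Quat U` on the hemisphere `σ·Re A ≥ 0`;
* `centralProj σ σ₄ P` — THE PROJECTION: every slice `combFlat (k ↦ centralRep σ_k (blockIm (wrapBlock k) k P))`, constant seam
  `centralRep σ₄ (seamIm P)`;
* ★★★ `ringDeficit_centralProj` — `F₀(π_C P) = 2L²·Σ_{k<l} 4(|z_k|²|z_l|² − (z_k·z_l)²) + L²·Σ_k 4(|z_k|²|z₄|² − (z_k·z₄)²)` with `z_k = blockIm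
  (wrapBlock k) k P`, `z₄ = seamIm P` — an explicit polynomial of degree four in the block averages (✓`CombConstant.ringDeficit_combConst`,
  ✓`su2Deficit_commutator_eq_imQuartic`), smooth in `P` with no square root;
* ★★ `centralProj_combConst` — `π_C` FIXES the comb-constant histories of the chart (`σ_k·Re A_k ≥ 0`, `σ₄·Re B ≥ 0`).

HONEST FRAMING: definitions and exact algebra; the subtracted-gradient field `A⁻¹(∇F₀ − ∇F₀∘π_C)`, its estimates and the patching are NOT
here; ⟨24141⟩ stays OPEN; the Yang–Mills mass gap is NOT proved; no summit is proved by a line.  0 `sorry`, standard axioms.  Width seat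
`ym-line-sfw-p2-w3` g58 (cell ym-idea-1, free hands), `--supports stmt-QuantumFields-24141`.
References: [cite: CosteEtAl1985]; [cite: Luscher1983, §2]; [cite: SeilerLNP1982, §2].
-/

set_option autoImplicit false

noncomputable section

open scoped Matrix Quaternion BigOperators
open Literature.MathematicalPhysics.QuantumFieldTheory hiding SU2
open Literature.MathematicalPhysics.QuantumLattice

namespace Summit.QuantumFields.YangMills.Theorems.VirialFluxGap.FrameDerivative

open Summit.QuantumFields.YangMills.Theorems.FemtoTransferGap
open Summit.QuantumFields.YangMills.Theorems.FemtoTransferGap.TwoLattice.Flat (combFlat combFlat_apply)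
open Summit.QuantumFields.YangMills.Theorems.VirialFluxGap.RingDeficit
open Summit.QuantumFields.YangMills.Theorems.VirialFluxGap.ConstantHistory
open Summit.QuantumFields.YangMills.Theorems.VirialFluxGap.CombConstant

variable {L : ℕ} [NeZero L]

/-! ## §1 Block data -/

/-- The block average of the imaginary parts over the links `(i,(x,k))`, `(i,x) ∈ S`: the zero-mode coordinate `z_S ∈ ℝ³`. [cite: CosteEtAl1985] -/
def blockIm (L : ℕ) [NeZero L] (S : Finset (Fin (2 * L - 1 + 1) × Site 3 L)) (k : Fin 3)
    (P : (Fin (2 * L - 1 + 1) → GaugeConfig 3 L SU2) × (Site 3 L → SU2)) : Fin 3 → ℝ :=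
  fun a => (∑ v ∈ S, (![(su2Quat (P.1 v.1 (v.2, k))).imI, (su2Quat (P.1 v.1 (v.2, k))).imJ,
    (su2Quat (P.1 v.1 (v.2, k))).imK] : Fin 3 → ℝ) a) / (S.card : ℝ)

/-- The seam average of the imaginary parts: the seam zero-mode coordinate `z₄ ∈ ℝ³`. [cite: CosteEtAl1985] -/
def seamIm (L : ℕ) [NeZero L] (P : (Fin (2 * L - 1 + 1) → GaugeConfig 3 L SU2) × (Site 3 L → SU2)) : Fin 3 → ℝ :=
  fun a => (∑ x : Site 3 L, (![(su2Quat (P.2 x)).imI, (su2Quat (P.2 x)).imJ, (su2Quat (P.2 x)).imK] : Fin 3 → ℝ) a) / ((L : ℝ) ^ 3)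

/-- The signed block coefficient is `½σ` times the block average. [folklore] -/
theorem bsliceCoeff_eq_blockIm (σ : ℝ) (S : Finset (Fin (2 * L - 1 + 1) × Site 3 L)) (k a : Fin 3)
    (P : (Fin (2 * L - 1 + 1) → GaugeConfig 3 L SU2) × (Site 3 L → SU2)) :
    bsliceCoeff L σ S k a P = (1 / 2 : ℝ) * σ * blockIm L S k P a := rfl

/-- The signed seam coefficient is `½σ` times the seam average. [folklore] -/
theorem zseamCoeff_eq_seamIm (σ : ℝ) (a : Fin 3) (P : (Fin (2 * L - 1 + 1) → GaugeConfig 3 L SU2) × (Site 3 L → SU2)) :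
    zseamCoeff L σ a P = (1 / 2 : ℝ) * σ * seamIm L P a := rfl

omit [NeZero L] in
/-- The imaginary part of a unit quaternion has `|Im|² ≤ 1`. [folklore] -/
theorem im_sq_le_one (U : SU2) : (su2Quat U).imI ^ 2 + (su2Quat U).imJ ^ 2 + (su2Quat U).imK ^ 2 ≤ 1 := by
  have h1 : Quaternion.normSq (su2Quat U) = 1 := normSq_su2Quat U
  rw [Quaternion.normSq_def'] at h1
  have : (su2Quat U).re ^ 2 + (su2Quat U).imI ^ 2 + (su2Quat U).imJ ^ 2 + (su2Quat U).imK ^ 2 = 1 := by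
    simpa only [sq] using h1
  nlinarith [sq_nonneg (su2Quat U).re]

omit [NeZero L] in
/-- An average of vectors of length `≤ 1` has length `≤ 1` (Cauchy–Schwarz). [folklore] -/
theorem normSq_avg_le_one {ι : Type*} (s : Finset ι) (f : ι → Fin 3 → ℝ) (hf : ∀ i ∈ s, (f i 0) ^ 2 + (f i 1) ^ 2 + (f i 2) ^ 2 ≤ 1) :
    ((∑ i ∈ s, f i 0) / (s.card : ℝ)) ^ 2 + ((∑ i ∈ s, f i 1) / (s.card : ℝ)) ^ 2 + ((∑ i ∈ s, f i 2) / (s.card : ℝ)) ^ 2 ≤ 1 := by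
  rcases s.eq_empty_or_nonempty with hs | hs
  · subst hs; norm_num
  have hc : (0 : ℝ) < (s.card : ℝ) := by exact_mod_cast hs.card_pos
  have h0 := sq_sum_le_card_mul_sum_sq (s := s) (f := fun i => f i 0)
  have h1 := sq_sum_le_card_mul_sum_sq (s := s) (f := fun i => f i 1)
  have h2 := sq_sum_le_card_mul_sum_sq (s := s) (f := fun i => f i 2)
  have hsum : (∑ i ∈ s, (f i 0) ^ 2) + (∑ i ∈ s, (f i 1) ^ 2) + (∑ i ∈ s, (f i 2) ^ 2) ≤ (s.card : ℝ) := by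
    rw [← Finset.sum_add_distrib, ← Finset.sum_add_distrib]
    calc ∑ i ∈ s, ((f i 0) ^ 2 + (f i 1) ^ 2 + (f i 2) ^ 2) ≤ ∑ i ∈ s, (1 : ℝ) := Finset.sum_le_sum hf
      _ = (s.card : ℝ) := by simp
  rw [div_pow, div_pow, div_pow, ← add_div, ← add_div, div_le_one (by positivity)]
  nlinarith

/-- ★ `|blockIm S k P|² ≤ 1`. [folklore] -/
theorem normSq_blockIm_le_one (S : Finset (Fin (2 * L - 1 + 1) × Site 3 L)) (k : Fin 3)
    (P : (Fin (2 * L - 1 + 1) → GaugeConfig 3 L SU2) × (Site 3 L → SU2)) :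
    (blockIm L S k P 0) ^ 2 + (blockIm L S k P 1) ^ 2 + (blockIm L S k P 2) ^ 2 ≤ 1 := by
  have h := normSq_avg_le_one S (fun v => ![(su2Quat (P.1 v.1 (v.2, k))).imI, (su2Quat (P.1 v.1 (v.2, k))).imJ,
    (su2Quat (P.1 v.1 (v.2, k))).imK]) (fun v _ => by simpa using im_sq_le_one (P.1 v.1 (v.2, k)))
  simpa [blockIm] using h

/-- ★ `|seamIm P|² ≤ 1`. [folklore] -/
theorem normSq_seamIm_le_one (P : (Fin (2 * L - 1 + 1) → GaugeConfig 3 L SU2) × (Site 3 L → SU2)) :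
    (seamIm L P 0) ^ 2 + (seamIm L P 1) ^ 2 + (seamIm L P 2) ^ 2 ≤ 1 := by
  have hsite : ((Finset.univ : Finset (Site 3 L)).card : ℝ) = (L : ℝ) ^ 3 := by
    rw [Finset.card_univ, TwoLattice.Electric.card_site]; push_cast; ring
  have h := normSq_avg_le_one (Finset.univ : Finset (Site 3 L)) (fun x => ![(su2Quat (P.2 x)).imI, (su2Quat (P.2 x)).imJ,
    (su2Quat (P.2 x)).imK]) (fun x _ => by simpa using im_sq_le_one (P.2 x))
  rw [hsite] at h
  simpa [seamIm] using h

/-! ## §2 The central lift -/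

omit [NeZero L] in
/-- The CENTRAL LIFT of block data: the quaternion `(σ√(1 − |z|²), z)`. [cite: CosteEtAl1985] -/
def liftQuat (σ : ℝ) (z : Fin 3 → ℝ) : ℍ := ⟨σ * Real.sqrt (1 - ((z 0) ^ 2 + (z 1) ^ 2 + (z 2) ^ 2)), z 0, z 1, z 2⟩

omit [NeZero L] in
/-- The central lift is a unit quaternion for `|z| ≤ 1`, `σ² = 1`. [folklore] -/
theorem normSq_liftQuat {σ : ℝ} (hσ : σ ^ 2 = 1) {z : Fin 3 → ℝ} (hz : (z 0) ^ 2 + (z 1) ^ 2 + (z 2) ^ 2 ≤ 1) :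
    Quaternion.normSq (liftQuat σ z) = 1 := by
  rw [Quaternion.normSq_def']
  simp only [liftQuat]
  have hs : Real.sqrt (1 - ((z 0) ^ 2 + (z 1) ^ 2 + (z 2) ^ 2)) ^ 2 = 1 - ((z 0) ^ 2 + (z 1) ^ 2 + (z 2) ^ 2) :=
    Real.sq_sqrt (by linarith)
  nlinarith

omit [NeZero L] in
/-- `‖liftQuat σ z‖ = 1`. [folklore] -/
theorem norm_liftQuat {σ : ℝ} (hσ : σ ^ 2 = 1) {z : Fin 3 → ℝ} (hz : (z 0) ^ 2 + (z 1) ^ 2 + (z 2) ^ 2 ≤ 1) : ‖liftQuat σ z‖ = 1 := by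
  have h := normSq_liftQuat hσ hz
  rw [Quaternion.normSq_eq_norm_mul_self] at h
  nlinarith [norm_nonneg (liftQuat σ z)]

omit [NeZero L] in
/-- ★ Hemisphere and radial factor of the central lift: `σ·Re = √(1 − |z|²) ≥ 1 − |z|²` (and `≥ 0`). [folklore] -/
theorem sign_mul_re_liftQuat {σ : ℝ} (hσ : σ ^ 2 = 1) {z : Fin 3 → ℝ} (hz : (z 0) ^ 2 + (z 1) ^ 2 + (z 2) ^ 2 ≤ 1) :
    0 ≤ σ * (liftQuat σ z).re ∧ 1 - ((z 0) ^ 2 + (z 1) ^ 2 + (z 2) ^ 2) ≤ σ * (liftQuat σ z).re := by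
  have he : σ * (liftQuat σ z).re = Real.sqrt (1 - ((z 0) ^ 2 + (z 1) ^ 2 + (z 2) ^ 2)) := by
    show σ * (σ * Real.sqrt _) = _
    rw [← mul_assoc, ← sq, hσ, one_mul]
  rw [he]
  refine ⟨Real.sqrt_nonneg _, ?_⟩
  have h0 : 0 ≤ 1 - ((z 0) ^ 2 + (z 1) ^ 2 + (z 2) ^ 2) := by linarith
  have h1 : 1 - ((z 0) ^ 2 + (z 1) ^ 2 + (z 2) ^ 2) ≤ 1 := by nlinarith [sq_nonneg (z 0), sq_nonneg (z 1), sq_nonneg (z 2)]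
  calc 1 - ((z 0) ^ 2 + (z 1) ^ 2 + (z 2) ^ 2) = Real.sqrt (1 - ((z 0) ^ 2 + (z 1) ^ 2 + (z 2) ^ 2)) ^ 2 := (Real.sq_sqrt h0).symm
    _ ≤ Real.sqrt (1 - ((z 0) ^ 2 + (z 1) ^ 2 + (z 2) ^ 2)) := by
        have hs1 : Real.sqrt (1 - ((z 0) ^ 2 + (z 1) ^ 2 + (z 2) ^ 2)) ≤ 1 := Real.sqrt_le_one.mpr h1
        nlinarith [Real.sqrt_nonneg (1 - ((z 0) ^ 2 + (z 1) ^ 2 + (z 2) ^ 2))]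

omit [NeZero L] in
/-- The CENTRAL REPRESENTATIVE in `SU(2)` of block data (✓`quatToSU2` of the central lift). [cite: CosteEtAl1985] -/
def centralRep (σ : ℝ) (z : Fin 3 → ℝ) : SU2 := quatToSU2 (liftQuat σ z)

omit [NeZero L] in
/-- `su2Quat` of a special unitary matrix of the form `quatMatrix r` is `r`. [folklore] -/
theorem su2Quat_eq_of_coe_eq {U : SU2} {r : ℍ} (h : (U : Matrix (Fin 2) (Fin 2) ℂ) = quatMatrix r) : su2Quat U = r := by
  obtain ⟨ρ, hρ, hρU⟩ := exists_firstRow_clm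
  rw [← hρU, h, firstRow_quatMatrix ρ hρ]

omit [NeZero L] in
/-- ★ The unit quaternion of the central representative is the central lift. [folklore] -/
theorem su2Quat_centralRep {σ : ℝ} (hσ : σ ^ 2 = 1) {z : Fin 3 → ℝ} (hz : (z 0) ^ 2 + (z 1) ^ 2 + (z 2) ^ 2 ≤ 1) :
    su2Quat (centralRep σ z) = liftQuat σ z :=
  su2Quat_eq_of_coe_eq (coe_quatToSU2_of_norm_eq_one (norm_liftQuat hσ hz))

omit [NeZero L] in
/-- ★ **The central lift of `Im A` on the hemisphere of `σ` is `A`**: `centralRep σ (Im(su2Quat U)) = U` when `σ·Re(su2Quat U) ≥ 0`, `σ = ±1`.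
[folklore] -/
theorem centralRep_im_su2Quat {σ : ℝ} (hσ : σ = 1 ∨ σ = -1) (U : SU2) (hhem : 0 ≤ σ * (su2Quat U).re) :
    centralRep σ ![(su2Quat U).imI, (su2Quat U).imJ, (su2Quat U).imK] = U := by
  have hσ2 : σ ^ 2 = 1 := by rcases hσ with h | h <;> simp [h]
  have him := im_sq_le_one U
  have hz : (![(su2Quat U).imI, (su2Quat U).imJ, (su2Quat U).imK] 0) ^ 2 + (![(su2Quat U).imI, (su2Quat U).imJ, (su2Quat U).imK] 1) ^ 2 +
      (![(su2Quat U).imI, (su2Quat U).imJ, (su2Quat U).imK] 2) ^ 2 ≤ 1 := by simpa using him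
  have hlift : liftQuat σ ![(su2Quat U).imI, (su2Quat U).imJ, (su2Quat U).imK] = su2Quat U := by
    have h1 : Quaternion.normSq (su2Quat U) = 1 := normSq_su2Quat U
    rw [Quaternion.normSq_def'] at h1
    have hre2 : (su2Quat U).re ^ 2 = 1 - ((su2Quat U).imI ^ 2 + (su2Quat U).imJ ^ 2 + (su2Quat U).imK ^ 2) := by
      have := h1; simp only [sq] at this ⊢; linarith
    have hsq : Real.sqrt (1 - ((su2Quat U).imI ^ 2 + (su2Quat U).imJ ^ 2 + (su2Quat U).imK ^ 2)) = |(su2Quat U).re| := by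
      rw [← hre2, Real.sqrt_sq_eq_abs]
    have hre : σ * |(su2Quat U).re| = (su2Quat U).re := by
      rcases hσ with h | h <;> subst h
      · rw [one_mul]; exact abs_of_nonneg (by linarith)
      · have : (su2Quat U).re ≤ 0 := by linarith
        rw [abs_of_nonpos this]; ring
    ext <;> simp [liftQuat, hsq, hre]
  apply Subtype.ext
  rw [centralRep, hlift, coe_quatToSU2_of_norm_eq_one (norm_su2Quat U), quatMatrix_su2Quat]

/-! ## §3 The central projection and its deficit -/

/-- ★ THE CENTRAL PROJECTION `π_C`: the comb-constant history with the same zero modes — wrap representatives `centralRep σ_k z_k`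
(`z_k` the wrap-block average of direction `k`), constant seam `centralRep σ₄ z₄`. [cite: CosteEtAl1985] -/
def centralProj (L : ℕ) [NeZero L] (σ : Fin 3 → ℝ) (σ₄ : ℝ) (P : (Fin (2 * L - 1 + 1) → GaugeConfig 3 L SU2) × (Site 3 L → SU2)) :
    (Fin (2 * L - 1 + 1) → GaugeConfig 3 L SU2) × (Site 3 L → SU2) :=
  ((fun _ : Fin (2 * L - 1 + 1) => combFlat (L := L) (fun k => centralRep (σ k) (blockIm L (wrapBlock L k) k P)),
    fun _ : Site 3 L => centralRep σ₄ (seamIm L P)))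

omit [NeZero L] in
/-- The commutator deficit of two unit quaternions with prescribed imaginary parts `z, z'` is the Lagrange quartic
`4(|z|²|z'|² − (z·z')²)`. [cite: CosteEtAl1985] -/
theorem su2Deficit_comm_of_im (U V : SU2) (z z' : Fin 3 → ℝ)
    (hU : (su2Quat U).imI = z 0 ∧ (su2Quat U).imJ = z 1 ∧ (su2Quat U).imK = z 2)
    (hV : (su2Quat V).imI = z' 0 ∧ (su2Quat V).imJ = z' 1 ∧ (su2Quat V).imK = z' 2) :
    su2Deficit (U * V * U⁻¹ * V⁻¹) =
      4 * ((z 0 * z 0 + z 1 * z 1 + z 2 * z 2) * (z' 0 * z' 0 + z' 1 * z' 1 + z' 2 * z' 2) -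
        (z 0 * z' 0 + z 1 * z' 1 + z 2 * z' 2) ^ 2) := by
  rw [su2Deficit_commutator_eq_imQuartic, hU.1, hU.2.1, hU.2.2, hV.1, hV.2.1, hV.2.2]

/-- ★★★ **The deficit of the central projection is an explicit quartic of the block averages**:
`F₀(π_C P) = 2L²·Σ_{k<l} 4(|z_k|²|z_l|² − (z_k·z_l)²) + L²·Σ_k 4(|z_k|²|z₄|² − (z_k·z₄)²)`, `z_k = blockIm (wrapBlock k) k P`, `z₄ = seamIm P`
(signs `σ ∈ {±1}`). [cite: CosteEtAl1985] -/
theorem ringDeficit_centralProj {σ : Fin 3 → ℝ} {σ₄ : ℝ} (hσ : ∀ k, σ k = 1 ∨ σ k = -1) (hσ₄ : σ₄ = 1 ∨ σ₄ = -1)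
    (P : (Fin (2 * L - 1 + 1) → GaugeConfig 3 L SU2) × (Site 3 L → SU2)) :
    ringDeficit L (fun _ => false) (centralProj L σ σ₄ P) =
      2 * (L : ℝ) ^ 2 * ∑ p : {p : Fin 3 × Fin 3 // p.1 < p.2},
          4 * ((blockIm L (wrapBlock L p.1.1) p.1.1 P 0 * blockIm L (wrapBlock L p.1.1) p.1.1 P 0 +
                blockIm L (wrapBlock L p.1.1) p.1.1 P 1 * blockIm L (wrapBlock L p.1.1) p.1.1 P 1 +
                blockIm L (wrapBlock L p.1.1) p.1.1 P 2 * blockIm L (wrapBlock L p.1.1) p.1.1 P 2) *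
              (blockIm L (wrapBlock L p.1.2) p.1.2 P 0 * blockIm L (wrapBlock L p.1.2) p.1.2 P 0 +
                blockIm L (wrapBlock L p.1.2) p.1.2 P 1 * blockIm L (wrapBlock L p.1.2) p.1.2 P 1 +
                blockIm L (wrapBlock L p.1.2) p.1.2 P 2 * blockIm L (wrapBlock L p.1.2) p.1.2 P 2) -
            (blockIm L (wrapBlock L p.1.1) p.1.1 P 0 * blockIm L (wrapBlock L p.1.2) p.1.2 P 0 +
              blockIm L (wrapBlock L p.1.1) p.1.1 P 1 * blockIm L (wrapBlock L p.1.2) p.1.2 P 1 +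
              blockIm L (wrapBlock L p.1.1) p.1.1 P 2 * blockIm L (wrapBlock L p.1.2) p.1.2 P 2) ^ 2) +
        (L : ℝ) ^ 2 * ∑ k : Fin 3,
          4 * ((blockIm L (wrapBlock L k) k P 0 * blockIm L (wrapBlock L k) k P 0 +
                blockIm L (wrapBlock L k) k P 1 * blockIm L (wrapBlock L k) k P 1 +
                blockIm L (wrapBlock L k) k P 2 * blockIm L (wrapBlock L k) k P 2) *
              (seamIm L P 0 * seamIm L P 0 + seamIm L P 1 * seamIm L P 1 + seamIm L P 2 * seamIm L P 2) -
            (blockIm L (wrapBlock L k) k P 0 * seamIm L P 0 + blockIm L (wrapBlock L k) k P 1 * seamIm L P 1 +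
              blockIm L (wrapBlock L k) k P 2 * seamIm L P 2) ^ 2) := by
  have hσ2 : ∀ k, σ k ^ 2 = 1 := fun k => by rcases hσ k with h | h <;> simp [h]
  have hσ₄2 : σ₄ ^ 2 = 1 := by rcases hσ₄ with h | h <;> simp [h]
  have hzk : ∀ k, (su2Quat (centralRep (σ k) (blockIm L (wrapBlock L k) k P))).imI = blockIm L (wrapBlock L k) k P 0 ∧
      (su2Quat (centralRep (σ k) (blockIm L (wrapBlock L k) k P))).imJ = blockIm L (wrapBlock L k) k P 1 ∧
      (su2Quat (centralRep (σ k) (blockIm L (wrapBlock L k) k P))).imK = blockIm L (wrapBlock L k) k P 2 := fun k => by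
    rw [su2Quat_centralRep (hσ2 k) (normSq_blockIm_le_one _ k P)]
    exact ⟨rfl, rfl, rfl⟩
  have hz₄ : (su2Quat (centralRep σ₄ (seamIm L P))).imI = seamIm L P 0 ∧ (su2Quat (centralRep σ₄ (seamIm L P))).imJ = seamIm L P 1 ∧
      (su2Quat (centralRep σ₄ (seamIm L P))).imK = seamIm L P 2 := by
    rw [su2Quat_centralRep hσ₄2 (normSq_seamIm_le_one P)]
    exact ⟨rfl, rfl, rfl⟩
  rw [centralProj, ringDeficit_combConst]
  congr 1
  · congr 1
    exact Finset.sum_congr rfl fun p _ => su2Deficit_comm_of_im _ _ _ _ (hzk p.1.1) (hzk p.1.2)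
  · congr 1
    exact Finset.sum_congr rfl fun k _ => su2Deficit_comm_of_im _ _ _ _ (hzk k) hz₄

/-! ## §4 `π_C` fixes the central family -/

/-- The wrap-block average of a comb-constant history is `Im(su2Quat h_k)`. [cite: Luscher1983, §2] -/
theorem blockIm_wrapBlock_combConst (k : Fin 3) (h : Fin 3 → SU2) (q : SU2) :
    blockIm L (wrapBlock L k) k ((fun _ : Fin (2 * L - 1 + 1) => combFlat (L := L) h, fun _ : Site 3 L => q) :
        (Fin (2 * L - 1 + 1) → GaugeConfig 3 L SU2) × (Site 3 L → SU2)) =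
      ![(su2Quat (h k)).imI, (su2Quat (h k)).imJ, (su2Quat (h k)).imK] := by
  funext a
  have hb := bsliceCoeff_wrapBlock_combConst (L := L) 2 k a h q
  rw [bsliceCoeff_eq_blockIm] at hb
  have e : (1 / 2 : ℝ) * 2 = 1 := by norm_num
  rw [e, one_mul, one_mul] at hb
  exact hb

/-- The seam average of a history with constant seam `q` is `Im(su2Quat q)`. [folklore] -/
theorem seamIm_of_const_seam (U : Fin (2 * L - 1 + 1) → GaugeConfig 3 L SU2) (q : SU2) :
    seamIm L ((U, fun _ : Site 3 L => q) : (Fin (2 * L - 1 + 1) → GaugeConfig 3 L SU2) × (Site 3 L → SU2)) =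
      ![(su2Quat q).imI, (su2Quat q).imJ, (su2Quat q).imK] := by
  funext a
  simp only [seamIm]
  have hL : (0 : ℝ) < (L : ℝ) := by exact_mod_cast NeZero.pos L
  have hN : ((L : ℝ) ^ 3) ≠ 0 := by positivity
  have hsite : (Fintype.card (Site 3 L) : ℝ) = (L : ℝ) ^ 3 := by
    rw [TwoLattice.Electric.card_site]; push_cast; ring
  rw [Finset.sum_const, Finset.card_univ, nsmul_eq_mul, hsite]
  field_simp

/-- ★★ **`π_C` fixes the comb-constant histories of the chart**: if every `h_k` is on the hemisphere of `σ_k` and `q` on that of `σ₄`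
(`σ ∈ {±1}`), then `centralProj σ σ₄ (combFlat h, q) = (combFlat h, q)`. [cite: CosteEtAl1985] -/
theorem centralProj_combConst {σ : Fin 3 → ℝ} {σ₄ : ℝ} (hσ : ∀ k, σ k = 1 ∨ σ k = -1) (hσ₄ : σ₄ = 1 ∨ σ₄ = -1)
    (h : Fin 3 → SU2) (q : SU2) (hhem : ∀ k, 0 ≤ σ k * (su2Quat (h k)).re) (hhem₄ : 0 ≤ σ₄ * (su2Quat q).re) :
    centralProj L σ σ₄ ((fun _ : Fin (2 * L - 1 + 1) => combFlat (L := L) h, fun _ : Site 3 L => q) :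
        (Fin (2 * L - 1 + 1) → GaugeConfig 3 L SU2) × (Site 3 L → SU2)) =
      ((fun _ : Fin (2 * L - 1 + 1) => combFlat (L := L) h, fun _ : Site 3 L => q) :
        (Fin (2 * L - 1 + 1) → GaugeConfig 3 L SU2) × (Site 3 L → SU2)) := by
  unfold centralProj
  have hk : ∀ k, centralRep (σ k) (blockIm L (wrapBlock L k) k ((fun _ : Fin (2 * L - 1 + 1) => combFlat (L := L) h,
      fun _ : Site 3 L => q) : (Fin (2 * L - 1 + 1) → GaugeConfig 3 L SU2) × (Site 3 L → SU2))) = h k := fun k => by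
    rw [blockIm_wrapBlock_combConst]
    exact centralRep_im_su2Quat (hσ k) (h k) (hhem k)
  have h₄ : centralRep σ₄ (seamIm L ((fun _ : Fin (2 * L - 1 + 1) => combFlat (L := L) h, fun _ : Site 3 L => q) :
      (Fin (2 * L - 1 + 1) → GaugeConfig 3 L SU2) × (Site 3 L → SU2))) = q := by
    rw [seamIm_of_const_seam]
    exact centralRep_im_su2Quat hσ₄ q hhem₄
  simp only [hk, h₄]

end Summit.QuantumFields.YangMills.Theorems.VirialFluxGap.FrameDerivative

end
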